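import Summits.NavierStokesRegularity.FluidComputer.GateBudgetSwingTransfer
import HarnessLib

/-!
# GateBudget part 102 — the swing transfer, II: the exit half band and the band sum (§280–§281)

Cell `pub-fluidc`, blueprint seat bp1 (gen 38, sixth item); namespace
`Summit.NavierStokesRegularity.FluidComputer.GateBudget`, knob family
`RotorKnob.rotorCircuit K M ε ρ` (modes `0 = a` carrier, `1 = b` clock, `2 = c` trigger,
`3 = d` transfer, `4 = ã` output) from `delayInit`, trigger primitive `C` (`C' = c`). Imports
part 101 (`GateBudgetSwingTransfer`: the entry half-band law; through it part 99's angle laws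
and swing primitive). HONEST FRAMING: a low prior, high value-of-information experiment on
Tao's machine paradigm; NOT a claim that NS blows up. Nothing here is about the Navier–Stokes
equations.

THE POINT (SPEC-INPUT-bp1 §BV–§BX, the swing law; fourth file). Part 101 priced the ENTRY
half of a symmetric swing band (`b(t₂) = -b(t₁)`) by the clock: for a phase-locked transfer
mode `d² ≤ A(sin²((C - C(r))/ρ² + φ₀) + E)` and `2C(t) ≤ C(t₁) + C(t₂)`,
`ã(t) - ã(t₁) ≤ (KA/(λR₂))·(swingPrim ψ₁ E₁ (α₁ + λ(C(t) - C(t₁))) - swingPrim ψ₁ E₁ α₁)`.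
This file is the MIRROR and the SUM. On the EXIT half `2C(t) ≥ C(t₁) + C(t₂)` the comparison
angle runs backward from the exit edge, `v = α₁ + λ(C(t₂) - C)` (`v' = -λc`), the same window
`v ≤ α ≤ π - v` holds (part 101 §279 `swing_window` with the exit-half inequality), the phase
of the transfer mode is `-(v + ψ₂) - (lag)` with the EXIT OFFSET
`ψ₂ = -(α₁ + Φ₁ + φ₀ + ε⁻¹M(C(t₂) - C(t₁)))` (`≡ -ψ₁ (mod π)` up to the lockstep excess
`δ = ε⁻¹M(C(t₂) - C(t₁)) - (π - 2α₁)`, `|δ| ≤ 4·10⁻⁴` at the headline by part 99's two angle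
laws; `sin²` is even and `π`-periodic), and
`ã + (KA/(λR₂))·swingPrim ψ₂ E₁ (v)` is non-increasing, so
`ã(t₂) - ã(t) ≤ (KA/(λR₂))·(swingPrim ψ₂ E₁ (v(t)) - swingPrim ψ₂ E₁ α₁)`. At a DOSE MIDPOINT
`2C(t_m) = C(t₁) + C(t₂)` (it exists: `C` is continuous and non-decreasing) both laws apply,
and with part 99 §275's price the whole band costs
`ã(t₂) - ã(t₁) ≤ (KA/(λR₂))·Σ_{ψ ∈ {ψ₁, ψ₂}} (cos²ψ cos α₁ + |sin 2ψ|(1 - sin α₁)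
- (sin²ψ + E₁) log tan(α₁/2))` — `≈ 1.96·KA/(λR₂)` at the headline edge with
`|ψ₁|, |ψ₂| ≤ 0.0079`, against the crude `K·(t₂ - t₁) ≤ 4.16K/(θK¹⁰)`.

* §280 `swingAngleBack`, `hasDerivAt_swingAngleBack` (the backward comparison angle, `-λc`);
  `swing_transfer_second`, THE EXIT HALF-BAND LAW (hypotheses of part 101 §279
  `swing_transfer_first` with the exit offset `ψ₂`; `t ∈ [t₁, t₂]`, `C(t₁) + C(t₂) ≤ 2C(t)`):
  `0 < α₁`, `C(t) ≤ C(t₂)`, `α₁ + λ(C(t₂) - C(t)) ≤ π/2`,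
  `ã(t₂) - ã(t) ≤ (KA/(λR₂))·(swingPrim ψ₂ E₁ (α₁ + λ(C(t₂) - C(t))) - swingPrim ψ₂ E₁ α₁)`;
  `swing_transfer_second_le` (priced).
* §281 `swing_transfer_band`, THE BAND LAW: `ã(t₂) - ã(t₁) ≤ (KA/(λR₂))·((cos²ψ₁ + cos²ψ₂)
  cos α₁ + (|sin 2ψ₁| + |sin 2ψ₂|)(1 - sin α₁) - (sin²ψ₁ + sin²ψ₂ + 2E₁)(log sin(α₁/2)
  - log cos(α₁/2)))`.

HONEST LIMITS. (i) Still GENERIC in the member with the phase locking ASSUMED: its discharge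
from part 14 §43 (`A = a(r)² + d(r)²`, `φ₀` the polar angle of `(a(r), d(r))`,
`EA = O(L(T' - r))`) and the headline instantiation (`R₂, Q, κ` of parts 99/100, `α₁` at
`cos α₁ ≈ 31/32`, `|ψ₁| ≤ 0.0075` from part 100's climb dose, `|ψ₂| ≤ |ψ₁| + 4·10⁻⁴`) are
part 103; (ii) `k = 1` only (unit lattice); (iii) the pulse ceiling `U₁ ≈ 1.85` (swing + part
74's climb and fall) and the ladder plumbing are parts 103–105 — until then
`U = 7/2 + k²/3` stands and the factor `≈ 2` at `K = 16` is a FORECAST; (iv) nothing about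
Navier–Stokes.
[cite: Tao2016AveragedNS, §5.5 Theorem 5.3, (5.5), (b-eq), (c-eq), (ta-eq), (energy-con)]
-/

noncomputable section

namespace Summit.NavierStokesRegularity.FluidComputer.GateBudget

open Real Set Filter Topology
open Literature.Analysis.FluidPDE.Tao2016AveragedNS

variable {K M ε ρ : ℝ} {X : ℝ → Fin 5 → ℝ} {C : ℝ → ℝ}

/-! ## §280 The exit half band -/

/-- §280(a) THE BACKWARD COMPARISON ANGLE run from the exit edge `t₂` at rate `λ`:
`v(s) = α₁ + λ(C(t₂) - C(s))`. [derived: this file] -/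
def swingAngleBack (α₁ lam : ℝ) (C : ℝ → ℝ) (t₂ s : ℝ) : ℝ := α₁ + lam * (C t₂ - C s)

/-- §280(a) its derivative along the flow is `-λc`. [derived: this file] -/
theorem hasDerivAt_swingAngleBack (hC : ∀ t, HasDerivAt C (X t 2) t) (α₁ lam t₂ s : ℝ) :
    HasDerivAt (swingAngleBack α₁ lam C t₂) (lam * -X s 2) s := by
  show HasDerivAt (fun s => α₁ + lam * (C t₂ - C s)) (lam * -X s 2) s
  exact (((hC s).const_sub (C t₂)).const_mul lam).const_add α₁

/-- §280(b) THE EXIT HALF-BAND LAW (any member from `delayInit`, `K ≥ 0`, `ε, M > 0`, UNIT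
LATTICE `ε⁻¹Mρ² = 1`; on the band `[t₁, t₂]`: the hypotheses of part 101 §279 `swing_window`,
`c ≥ 0`, and a PHASE-LOCKED transfer mode `d² ≤ A(sin²((C - C(r))/ρ² + φ₀) + E)`,
`A, E ≥ 0`, `0 < κ ≤ 1`; abbreviations `λ = ε⁻¹Mκ`, `α₁ = arccos(b(t₁)/R₂)`, the EXIT OFFSET
`ψ₂ = -(α₁ + (C(t₁) - C(r))/ρ² + φ₀ + ε⁻¹M(C(t₂) - C(t₁)))`, `E₁ = E + π(κ⁻¹ - 1)`). For
`t ∈ [t₁, t₂]` in the EXIT HALF `C(t₁) + C(t₂) ≤ 2C(t)`: `0 < α₁`, `C(t) ≤ C(t₂)`,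
`α₁ + λ(C(t₂) - C(t)) ≤ π/2`, and
`ã(t₂) - ã(t) ≤ (KA/(λR₂))·(swingPrim ψ₂ E₁ (α₁ + λ(C(t₂) - C(t))) - swingPrim ψ₂ E₁ α₁)`
(the comparison `ã + (KA/(λR₂))·swingPrim ψ₂ E₁ (v)` is non-increasing on `[t, t₂]`).
[derived: part 99 §274–§275; part 101 §278–§279] -/
theorem swing_transfer_second
    (hX : ∀ t, HasDerivAt X (RotorKnob.rotorCircuit K M ε ρ (X t)) t) (h0 : X 0 = delayInit)
    (hC : ∀ t, HasDerivAt C (X t 2) t) (hK : 0 ≤ K) (hε : 0 < ε) (hM : 0 < M)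
    (hlat : ε⁻¹ * M * ρ ^ 2 = 1) {t₁ t₂ r R₂ Q κ A E φ₀ α₁ ψ₂ E₁ : ℝ} (ht : t₁ ≤ t₂)
    (hR : 0 < R₂) (hQ : R₂ ^ 2 + ε ^ 2 / M ≤ Q) (hκ0 : 0 < κ) (hκ1 : κ ≤ 1) (hA : 0 ≤ A)
    (hE : 0 ≤ E) (hring : ∀ u ∈ Icc t₁ t₂, Q ≤ X u 1 ^ 2 + X u 2 ^ 2)
    (hband : ∀ u ∈ Icc t₁ t₂, X u 1 ^ 2 < R₂ ^ 2)
    (hκ : ∀ u ∈ Icc t₁ t₂, κ * X u 2 ≤ √(R₂ ^ 2 - X u 1 ^ 2))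
    (hpos : ∀ u ∈ Icc t₁ t₂, 0 ≤ X u 2) (hsym : X t₂ 1 = -X t₁ 1)
    (hd : ∀ u ∈ Icc t₁ t₂, X u 3 ^ 2 ≤ A * (sin ((C u - C r) / ρ ^ 2 + φ₀) ^ 2 + E))
    (hα₁ : α₁ = arccos (X t₁ 1 / R₂))
    (hψ₂ : ψ₂ = -(α₁ + ((C t₁ - C r) / ρ ^ 2 + φ₀) + ε⁻¹ * M * (C t₂ - C t₁)))
    (hE₁ : E₁ = E + π * (κ⁻¹ - 1)) {t : ℝ} (ht₁ : t ∈ Icc t₁ t₂)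
    (hhalf : C t₁ + C t₂ ≤ 2 * C t) :
    0 < α₁ ∧ C t ≤ C t₂ ∧ α₁ + ε⁻¹ * M * κ * (C t₂ - C t) ≤ π / 2 ∧
      X t₂ 4 - X t 4 ≤ K * A / (ε⁻¹ * M * κ * R₂) *
        (swingPrim ψ₂ E₁ (α₁ + ε⁻¹ * M * κ * (C t₂ - C t)) - swingPrim ψ₂ E₁ α₁) := by
  obtain ⟨lam, hlam⟩ : ∃ lam : ℝ, lam = ε⁻¹ * M * κ := ⟨_, rfl⟩
  rw [← hlam]
  have hμ0 : 0 < ε⁻¹ * M := by positivity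
  have hlam0 : 0 < lam := by rw [hlam]; positivity
  have hρ2 : (ρ ^ 2)⁻¹ = ε⁻¹ * M := inv_eq_of_mul_eq_one_left hlat
  have hκinv : 0 ≤ κ⁻¹ - 1 := sub_nonneg.2 ((one_le_inv₀ hκ0).2 hκ1)
  have hE₁0 : 0 ≤ E₁ := by rw [hE₁]; positivity
  have hkk : κ⁻¹ * κ = 1 := inv_mul_cancel₀ hκ0.ne'
  -- `C` is non-decreasing on the band
  have hCm := Thm53.monotoneOn_sub_of_le_deriv (f := C) (f' := fun u => X u 2)
    (Φ := fun _ => (0 : ℝ)) (φ := fun _ => 0) (convex_Icc t₁ t₂) (fun u _ => hC u)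
    (fun u _ => hasDerivAt_const u 0) (fun u hu => hpos u hu)
  have hα0 : 0 < α₁ := by
    rw [hα₁]; exact (swing_window hX h0 hC hε hM ht hR hQ hring hband hκ hsym ht₁).2.2
  -- the pointwise facts on `[t, t₂]`
  have KEY : ∀ s ∈ Icc t t₂, 0 < swingAngleBack α₁ lam C t₂ s ∧
      swingAngleBack α₁ lam C t₂ s ≤ π / 2 ∧ C s ≤ C t₂ ∧ K * X s 3 ^ 2 ≤ K * A / (lam * R₂) *
        ((sin (swingAngleBack α₁ lam C t₂ s + ψ₂) ^ 2 + E₁) / sin (swingAngleBack α₁ lam C t₂ s)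
          * (lam * X s 2)) := by
    intro s hs
    have hs2 : s ∈ Icc t₁ t₂ := ⟨ht₁.1.trans hs.1, hs.2⟩
    obtain ⟨h1, h2, -⟩ := swing_window hX h0 hC hε hM ht hR hQ hring hband hκ hsym hs2
    rw [← hlam, ← hα₁] at h1 h2
    have hc2 := hCm hs2 (right_mem_Icc.2 ht) hs.2
    have hc3 := hCm ht₁ hs2 hs.1
    dsimp only at hc2 hc3
    have hc2' : C s ≤ C t₂ := by linarith only [hc2]
    have hsecond : lam * (C t₂ - C s) ≤ lam * (C s - C t₁) :=
      mul_le_mul_of_nonneg_left (by linarith only [hc3, hhalf]) hlam0.le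
    unfold swingAngleBack
    obtain ⟨v, hv⟩ : ∃ v : ℝ, v = α₁ + lam * (C t₂ - C s) := ⟨_, rfl⟩
    rw [← hv]
    have hvle : v ≤ arccos (X s 1 / R₂) := by rw [hv]; linarith only [h1, hsecond]
    have hvge : arccos (X s 1 / R₂) ≤ π - v := by rw [hv]; linarith only [h2]
    have hv0 : 0 < v := by
      rw [hv]
      have := mul_nonneg hlam0.le (sub_nonneg.2 hc2')
      linarith only [this, hα0]
    have hvπ : v ≤ π / 2 := by linarith only [hvle, hvge]
    have hsv : 0 < sin v := sin_pos_of_pos_of_lt_pi hv0 (by linarith only [hvπ, pi_pos])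
    have hsin : sin v ≤ sin (arccos (X s 1 / R₂)) := sin_le_sin_of_window hv0.le hvle hvge
    have hring2 : R₂ ^ 2 ≤ X s 1 ^ 2 + X s 2 ^ 2 := by
      have h3 := hring s hs2
      have h4 : 0 ≤ ε ^ 2 / M := by positivity
      linarith only [h3, h4, hQ]
    have hcs : R₂ * sin v ≤ X s 2 :=
      (mul_le_mul_of_nonneg_left hsin hR.le).trans (trigger_ge_sin_angle hR hring2 (hpos s hs2))
    -- the phase of the transfer mode is `-(v + ψ₂)` up to the lag `(ε⁻¹M - λ)(C t₂ - C s)`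
    have hl1 : (C s - C r) / ρ ^ 2 + φ₀ = -((v + ψ₂) + (ε⁻¹ * M - lam) * (C t₂ - C s)) := by
      rw [hv, hψ₂, div_eq_mul_inv, div_eq_mul_inv, hρ2]
      ring
    have hl2 : (κ⁻¹ - 1) * (lam * (C t₂ - C s)) = (ε⁻¹ * M - lam) * (C t₂ - C s) := by
      rw [hlam]
      calc (κ⁻¹ - 1) * (ε⁻¹ * M * κ * (C t₂ - C s))
            = (κ⁻¹ * κ) * (ε⁻¹ * M * (C t₂ - C s)) - ε⁻¹ * M * κ * (C t₂ - C s) := by ring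
        _ = (ε⁻¹ * M - ε⁻¹ * M * κ) * (C t₂ - C s) := by rw [hkk]; ring
    have hlb : 2 * |(ε⁻¹ * M - lam) * (C t₂ - C s)| ≤ π * (κ⁻¹ - 1) := by
      have hn : 0 ≤ (κ⁻¹ - 1) * (lam * (C t₂ - C s)) :=
        mul_nonneg hκinv (mul_nonneg hlam0.le (sub_nonneg.2 hc2'))
      rw [← hl2, abs_of_nonneg hn]
      have hle : lam * (C t₂ - C s) ≤ π / 2 := by linarith only [hvπ, hv, hα0]
      have := mul_le_mul_of_nonneg_left hle hκinv
      linarith only [this]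
    have hds : X s 3 ^ 2 ≤ A * (sin (v + ψ₂) ^ 2 + E₁) := by
      have h := hd s hs2
      rw [hl1, sin_neg, neg_sq] at h
      have hsh := mul_le_mul_of_nonneg_left
        (sin_sq_shift_le (v + ψ₂) ((ε⁻¹ * M - lam) * (C t₂ - C s))) hA
      have hlb' := mul_le_mul_of_nonneg_left hlb hA
      rw [hE₁]
      linarith only [h, hsh, hlb']
    exact ⟨hv0, hvπ, hc2', swing_step_le hK hA hlam0 hR hsv hE₁0 hds hcs⟩
  -- the comparison `ã + (KA/(λR₂))·swingPrim ψ₂ E₁ (v)` is non-increasing on `[t, t₂]`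
  have hanti := Thm53.antitoneOn_sub_of_deriv_le (f := fun s => X s 4)
    (f' := fun s => K * X s 3 ^ 2)
    (Φ := fun s => -(K * A / (lam * R₂) * swingPrim ψ₂ E₁ (swingAngleBack α₁ lam C t₂ s)))
    (φ := fun s => K * A / (lam * R₂) *
      ((sin (swingAngleBack α₁ lam C t₂ s + ψ₂) ^ 2 + E₁) / sin (swingAngleBack α₁ lam C t₂ s)
        * (lam * X s 2)))
    (convex_Icc t t₂) (fun s _ => RotorKnob.hasDerivAt_e hX s)
    (fun s hs => ((((hasDerivAt_swingPrim ψ₂ E₁ (KEY s hs).1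
      (by linarith only [(KEY s hs).2.1, pi_pos])).comp s
        (hasDerivAt_swingAngleBack hC α₁ lam t₂ s)).const_mul (K * A / (lam * R₂))).neg
          ).congr_deriv (by ring))
    (fun s hs => (KEY s hs).2.2.2)
  have h := hanti (left_mem_Icc.2 ht₁.2) (right_mem_Icc.2 ht₁.2) ht₁.2
  have hK1 := KEY t (left_mem_Icc.2 ht₁.2)
  simp only [swingAngleBack, sub_self, mul_zero, add_zero, sub_neg_eq_add] at h hK1
  exact ⟨hα0, hK1.2.2.1, hK1.2.1, by linarith only [h]⟩

/-- §280(c) THE EXIT HALF-BAND LAW, PRICED (same hypotheses): with part 99 §275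
`swingPrim_eval_le`, `ã(t₂) - ã(t) ≤ (KA/(λR₂))·(cos²ψ₂·cos α₁ + |sin 2ψ₂|·(1 - sin α₁)
- (sin²ψ₂ + E₁)·(log sin(α₁/2) - log cos(α₁/2)))`. [derived: this file §280(b); part 99 §275] -/
theorem swing_transfer_second_le
    (hX : ∀ t, HasDerivAt X (RotorKnob.rotorCircuit K M ε ρ (X t)) t) (h0 : X 0 = delayInit)
    (hC : ∀ t, HasDerivAt C (X t 2) t) (hK : 0 ≤ K) (hε : 0 < ε) (hM : 0 < M)
    (hlat : ε⁻¹ * M * ρ ^ 2 = 1) {t₁ t₂ r R₂ Q κ A E φ₀ α₁ ψ₂ E₁ : ℝ} (ht : t₁ ≤ t₂)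
    (hR : 0 < R₂) (hQ : R₂ ^ 2 + ε ^ 2 / M ≤ Q) (hκ0 : 0 < κ) (hκ1 : κ ≤ 1) (hA : 0 ≤ A)
    (hE : 0 ≤ E) (hring : ∀ u ∈ Icc t₁ t₂, Q ≤ X u 1 ^ 2 + X u 2 ^ 2)
    (hband : ∀ u ∈ Icc t₁ t₂, X u 1 ^ 2 < R₂ ^ 2)
    (hκ : ∀ u ∈ Icc t₁ t₂, κ * X u 2 ≤ √(R₂ ^ 2 - X u 1 ^ 2))
    (hpos : ∀ u ∈ Icc t₁ t₂, 0 ≤ X u 2) (hsym : X t₂ 1 = -X t₁ 1)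
    (hd : ∀ u ∈ Icc t₁ t₂, X u 3 ^ 2 ≤ A * (sin ((C u - C r) / ρ ^ 2 + φ₀) ^ 2 + E))
    (hα₁ : α₁ = arccos (X t₁ 1 / R₂))
    (hψ₂ : ψ₂ = -(α₁ + ((C t₁ - C r) / ρ ^ 2 + φ₀) + ε⁻¹ * M * (C t₂ - C t₁)))
    (hE₁ : E₁ = E + π * (κ⁻¹ - 1)) {t : ℝ} (ht₁ : t ∈ Icc t₁ t₂)
    (hhalf : C t₁ + C t₂ ≤ 2 * C t) :
    X t₂ 4 - X t 4 ≤ K * A / (ε⁻¹ * M * κ * R₂) *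
      (cos ψ₂ ^ 2 * cos α₁ + |sin (2 * ψ₂)| * (1 - sin α₁)
        - (sin ψ₂ ^ 2 + E₁) * (log (sin (α₁ / 2)) - log (cos (α₁ / 2)))) := by
  obtain ⟨hα0, hc2, hvπ, h⟩ := swing_transfer_second hX h0 hC hK hε hM hlat ht hR hQ hκ0 hκ1
    hA hE hring hband hκ hpos hsym hd hα₁ hψ₂ hE₁ ht₁ hhalf
  have hE₁0 : 0 ≤ E₁ := by
    rw [hE₁]
    have : 0 ≤ κ⁻¹ - 1 := sub_nonneg.2 ((one_le_inv₀ hκ0).2 hκ1)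
    positivity
  have hlam0 : 0 < ε⁻¹ * M * κ := by positivity
  have hαv : α₁ ≤ α₁ + ε⁻¹ * M * κ * (C t₂ - C t) := by
    have := mul_nonneg hlam0.le (sub_nonneg.2 hc2)
    linarith only [this]
  have hev := swingPrim_eval_le ψ₂ hE₁0 hα0 hαv hvπ
  have hcoef : 0 ≤ K * A / (ε⁻¹ * M * κ * R₂) := by positivity
  exact h.trans (mul_le_mul_of_nonneg_left hev hcoef)

/-! ## §281 The whole band -/

/-- §281 THE BAND LAW (hypotheses of §279/§280 with both offsets `ψ₁`, `ψ₂`): splitting at a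
dose midpoint `2C(t_m) = C(t₁) + C(t₂)` (it exists by the intermediate value theorem, `C`
being continuous and non-decreasing on the band) and adding the two priced half-band laws,
`ã(t₂) - ã(t₁) ≤ (KA/(λR₂))·((cos²ψ₁ + cos²ψ₂)·cos α₁ + (|sin 2ψ₁| + |sin 2ψ₂|)·(1 - sin α₁)
- (sin²ψ₁ + sin²ψ₂ + 2E₁)·(log sin(α₁/2) - log cos(α₁/2)))`.
[derived: part 101 §279(c); this file §280(c)] -/
theorem swing_transfer_band
    (hX : ∀ t, HasDerivAt X (RotorKnob.rotorCircuit K M ε ρ (X t)) t) (h0 : X 0 = delayInit)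
    (hC : ∀ t, HasDerivAt C (X t 2) t) (hK : 0 ≤ K) (hε : 0 < ε) (hM : 0 < M)
    (hlat : ε⁻¹ * M * ρ ^ 2 = 1) {t₁ t₂ r R₂ Q κ A E φ₀ α₁ ψ₁ ψ₂ E₁ : ℝ} (ht : t₁ ≤ t₂)
    (hR : 0 < R₂) (hQ : R₂ ^ 2 + ε ^ 2 / M ≤ Q) (hκ0 : 0 < κ) (hκ1 : κ ≤ 1) (hA : 0 ≤ A)
    (hE : 0 ≤ E) (hring : ∀ u ∈ Icc t₁ t₂, Q ≤ X u 1 ^ 2 + X u 2 ^ 2)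
    (hband : ∀ u ∈ Icc t₁ t₂, X u 1 ^ 2 < R₂ ^ 2)
    (hκ : ∀ u ∈ Icc t₁ t₂, κ * X u 2 ≤ √(R₂ ^ 2 - X u 1 ^ 2))
    (hpos : ∀ u ∈ Icc t₁ t₂, 0 ≤ X u 2) (hsym : X t₂ 1 = -X t₁ 1)
    (hd : ∀ u ∈ Icc t₁ t₂, X u 3 ^ 2 ≤ A * (sin ((C u - C r) / ρ ^ 2 + φ₀) ^ 2 + E))
    (hα₁ : α₁ = arccos (X t₁ 1 / R₂)) (hψ₁ : ψ₁ = (C t₁ - C r) / ρ ^ 2 + φ₀ - α₁)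
    (hψ₂ : ψ₂ = -(α₁ + ((C t₁ - C r) / ρ ^ 2 + φ₀) + ε⁻¹ * M * (C t₂ - C t₁)))
    (hE₁ : E₁ = E + π * (κ⁻¹ - 1)) :
    X t₂ 4 - X t₁ 4 ≤ K * A / (ε⁻¹ * M * κ * R₂) *
      ((cos ψ₁ ^ 2 + cos ψ₂ ^ 2) * cos α₁ + (|sin (2 * ψ₁)| + |sin (2 * ψ₂)|) * (1 - sin α₁)
        - (sin ψ₁ ^ 2 + sin ψ₂ ^ 2 + 2 * E₁) * (log (sin (α₁ / 2)) - log (cos (α₁ / 2)))) := by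
  -- a dose midpoint exists
  have hcont : ContinuousOn C (Icc t₁ t₂) := fun u _ => (hC u).continuousAt.continuousWithinAt
  have hCm := Thm53.monotoneOn_sub_of_le_deriv (f := C) (f' := fun u => X u 2)
    (Φ := fun _ => (0 : ℝ)) (φ := fun _ => 0) (convex_Icc t₁ t₂) (fun u _ => hC u)
    (fun u _ => hasDerivAt_const u 0) (fun u hu => hpos u hu)
  have hc12 := hCm (left_mem_Icc.2 ht) (right_mem_Icc.2 ht) ht
  dsimp only at hc12
  have hmid : (C t₁ + C t₂) / 2 ∈ Icc (C t₁) (C t₂) := by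
    constructor <;> linarith only [hc12]
  obtain ⟨tm, htm, hCtm⟩ := intermediate_value_Icc ht hcont hmid
  have hle : 2 * C tm ≤ C t₁ + C t₂ := by rw [hCtm]; linarith only
  have hge : C t₁ + C t₂ ≤ 2 * C tm := by rw [hCtm]; linarith only
  have h1 := swing_transfer_first_le hX h0 hC hK hε hM hlat ht hR hQ hκ0 hκ1 hA hE hring hband
    hκ hpos hsym hd hα₁ hψ₁ hE₁ htm hle
  have h2 := swing_transfer_second_le hX h0 hC hK hε hM hlat ht hR hQ hκ0 hκ1 hA hE hring hband
    hκ hpos hsym hd hα₁ hψ₂ hE₁ htm hge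
  have hsum : X t₂ 4 - X t₁ 4 = (X t₂ 4 - X tm 4) + (X tm 4 - X t₁ 4) := by ring
  rw [hsum]
  have e : K * A / (ε⁻¹ * M * κ * R₂) *
      ((cos ψ₁ ^ 2 + cos ψ₂ ^ 2) * cos α₁ + (|sin (2 * ψ₁)| + |sin (2 * ψ₂)|) * (1 - sin α₁)
        - (sin ψ₁ ^ 2 + sin ψ₂ ^ 2 + 2 * E₁) * (log (sin (α₁ / 2)) - log (cos (α₁ / 2))))
      = K * A / (ε⁻¹ * M * κ * R₂) *
          (cos ψ₂ ^ 2 * cos α₁ + |sin (2 * ψ₂)| * (1 - sin α₁)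
            - (sin ψ₂ ^ 2 + E₁) * (log (sin (α₁ / 2)) - log (cos (α₁ / 2))))
        + K * A / (ε⁻¹ * M * κ * R₂) *
          (cos ψ₁ ^ 2 * cos α₁ + |sin (2 * ψ₁)| * (1 - sin α₁)
            - (sin ψ₁ ^ 2 + E₁) * (log (sin (α₁ / 2)) - log (cos (α₁ / 2)))) := by
    ring
  rw [e]
  exact add_le_add h2 h1

end Summit.NavierStokesRegularity.FluidComputer.GateBudget
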